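import Summits.BirchSwinnertonDyer.Rank1Residual.Additive.RamifiedOrdinaryLineUnique
import HarnessLib

/-!
# Uniqueness of the (ramified) ordinary line — DATUM-LEVEL form: any Greenberg datum `C ⊂ E[p^∞]`
# that is `p`-divisible with `#C[p] = p` and on which ONE inertia element acts as a scalar `u > 1`
# is the only `p`-divisible proper subgroup with inertia-power-trivial quotient (cell `b2b-bsdres`,
# lane CLASS-CLOSURE, seat cc-typer-2; serves the (M) rows of team n1011 (Tate datum) as the
# good-ordinary rows (reduction datum) — R5-47 (b))

HONEST FRAMING (cell `b2b-bsdres`, run/shared/lean/b2b/bsd-rank1-residual/, verbatim in every file):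
the goal of the cell is to DELETE the COMBINATION-SHAPED residual classes of the Birch–Swinnerton-Dyer
formula for ALL analytic-rank `≤ 1` elliptic curves over `ℚ` — assembled STRICTLY from published
theorems — so that the rank-`≤ 1` remainder becomes exactly the CONSTRUCTION-SHAPED classes, which are
TYPED (missing-input `Prop`s), NOT attempted. This is not "finishing BSD". Team n1011 / lane
CLASS-CLOSURE: research routes; no claim beyond stated classes; census output = EVIDENCE, never a
Literature fact; RESIDUAL-MAP marks UNCHANGED; nothing is booked by this file. Theorems only: NO
definition, NO named fact, NO conjecture node.

WHAT. `RamifiedOrdinaryLineUnique.eq_reductionDatum_plus` proved uniqueness for Greenberg's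
REDUCTION datum through the generator calculus of `OrdinaryLineInertiaCyclotomic`. The argument only
uses three properties of the datum `C`: (a) `C` is `p`-divisible; (b) `#(C ∩ E[p^∞][p]) = p` (with
`#E[p^∞][p] = p²` this makes `D = E[p^∞]/C` a copy of `ℚ_p/ℤ_p`: X2
`TrivialZeroCorankAlgebra.finite_and_natCard_torsionBy_gr`); (c) SOME local inertia element acts on
`C` as multiplication by a natural number `u > 1` (an element of infinite order of `Aut C`). This file
states it at that level:

* **`LocalDatum.plus_eq_of_inertia_scalar`** — for any `N : LocalDatum ℚ E[p^∞] v` with (a)(b)(c),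
  every `p`-divisible `X ≠ ⊤` in `E[p^∞]` such that some power `σ^{N₀}` (`N₀ ≥ 1`) of every local
  inertia element acts trivially on `E[p^∞]/X` equals `N.plus` (`(u^{N₀} − 1)•C ⊆ X`, `C` is
  `(u^{N₀}−1)`-divisible ⇒ `C ⊆ X`; `X/C` is `p`-divisible in `D ≅ ℚ_p/ℤ_p` and `≠ ⊤` ⇒ `= ⊥`);
  `LocalDatum.plus_eq_plus_of_isRamifiedOrdinaryLine_of_inertia_scalar` — hence any ramified
  ordinary line (`EmertonPollackWeston2006.IsRamifiedOrdinaryLine`) of THE SAME curve equals `N.plus`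
  whenever `N` has (a)(b)(c) (e.g. `N` itself a ramified ordinary line with (b)(c));
* **`reductionDatum_inertia_scalar`** — (c) for Greenberg's reduction datum of a good-ordinary `V`
  (`u = 1 + p`: the inertia element with `χ_p(σ₁) = 1 + p` of `OrdinaryLineInertiaCyclotomic` acts
  on ALL of `C_v` as `1 + p`), and the re-derivation `eq_reductionDatum_plus'` of §2 of the sibling
  from the datum-level theorem.
* (M) ROWS (team n1011 T-RD-M, seat p07 — one statement one owner, NOT proved here): for the Tate
  datum `C = ι⁻¹Φ(μ)` (X2 `GreenbergVatsalTateDatum.tateDatum`), (a) = `tateDatum_plus_divisible`,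
  (b) = `natCard_tateDatum_plus_inf_torsionBy` (tree), and (c) holds with `u = (1+p)²`: for `σ₁` with
  `χ_p(σ₁) = 1 + p`, `σ₁Φ(ζ) = ±Φ(ζ^{1+p})`, so `σ₁²` acts on `C` as `(1+p)²` whatever the signs —
  one invocation of `LocalDatum.plus_eq_of_inertia_scalar` then gives uniqueness on the (M) rows.

References: Greenberg LNM 1716 §2 pp. 63, 69–70 [GreenbergLNM1716]; Greenberg–Vatsal 2000 §2 pp. 14–16,
26 [GreenbergVatsal2000]; Silverman *AEC* III.8.1 [SilvermanAEC2009].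
-/

noncomputable section

open scoped Classical AddSubgroup NNReal

open NumberField IsDedekindDomain Field
  Literature.NumberTheory.GaloisRepresentations
  Literature.NumberTheory.EllipticCurves
  Literature.NumberTheory.EllipticCurves.GreenbergSelmer
  Literature.NumberTheory.EllipticCurves.EmertonPollackWeston2006
  IsDedekindDomain.HeightOneSpectrum
  Summit.BirchSwinnertonDyer.Rank1Residual.X2
  Summit.BirchSwinnertonDyer.Rank1Residual.X2.GreenbergVatsalTorsion
  Summit.BirchSwinnertonDyer.Rank1Residual.X2.GreenbergVatsalReductionDatum
  Summit.BirchSwinnertonDyer.Rank1Residual.X2.TrivialZeroCorankAlgebra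
  Summit.BirchSwinnertonDyer.Rank1Residual.GaloisImage.OrdinaryLineInertiaCyclotomic
  Summit.BirchSwinnertonDyer.Rank1Residual.Additive.RamifiedOrdinaryLineUnique
open WeierstrassCurve (minimalDiscriminantInt integralModelInt)

universe u

/-! ## §1. Datum-level uniqueness -/

namespace Literature.NumberTheory.EllipticCurves.GreenbergSelmer.LocalDatum

variable {W : WeierstrassCurve ℚ} [W.IsElliptic] {p : ℕ} [hp : Fact p.Prime]
  {v : HeightOneSpectrum (𝓞 ℚ)} (N : LocalDatum ℚ ↥(W.geomPrimaryTorsion p) v)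

/-- **Datum-level uniqueness of the ordinary line.** Let `N` be a local datum of `E[p^∞]` at `v` whose
`C = N.plus` is (a) `p`-divisible, (b) has `#(C ∩ E[p^∞][p]) = p`, and (c) carries a local inertia
element acting as a natural scalar `u > 1`. Then every `p`-divisible `X ≠ ⊤` in `E[p^∞]` on whose
quotient some power `σ^{N₀}` (`N₀ ≥ 1`) of every local inertia element acts trivially is `C`.
(GV p. 26: "`C` is determined by the action of `I_p`"; Greenberg LNM 1716 p. 63.)
[cite: GreenbergVatsal2000, §2 p. 26] [cite: GreenbergLNM1716, §2 p. 63] -/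
theorem plus_eq_of_inertia_scalar
    (hCdiv : ∀ c ∈ N.plus, ∃ c' ∈ N.plus, p • c' = c)
    (hCp : Nat.card ↥(N.plus ⊓ (↥(W.geomPrimaryTorsion p))[(p : ℤ)]) = p)
    (hσ : ∃ σ ∈ absInertia (v.adicCompletion ℚ), ∃ u : ℕ, 1 < u ∧
      ∀ m ∈ N.plus, absGaloisRestrict ℚ (v.adicCompletion ℚ) σ • m = u • m)
    (X : AddSubgroup ↥(W.geomPrimaryTorsion p))
    (hdiv : ∀ m ∈ X, ∃ m' ∈ X, p • m' = m) (htop : X ≠ ⊤)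
    (hN : ∃ N₀ : ℕ, 0 < N₀ ∧ ∀ σ ∈ absInertia (v.adicCompletion ℚ), ∀ m : ↥(W.geomPrimaryTorsion p),
      (absGaloisRestrict ℚ (v.adicCompletion ℚ) σ) ^ N₀ • m - m ∈ X) :
    X = N.plus := by
  obtain ⟨N₀, hN₀pos, hN⟩ := hN
  obtain ⟨σ₁, hσ₁I, u, hu, hσ₁⟩ := hσ
  set C := N.plus with hCdef
  have hprim := exists_pow_nsmul_eq_zero W p
  -- Galois elements commute with integer multiples
  have hcomm : ∀ (g : absoluteGaloisGroup ℚ) (c : ℕ) (m : ↥(W.geomPrimaryTorsion p)),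
      g • (c • m) = c • (g • m) := fun g c m ↦
    map_nsmul (DistribSMul.toAddMonoidHom ↥(W.geomPrimaryTorsion p) g) c m
  -- `σ₁^n` acts on `C` as `u^n`
  have hpow : ∀ (n : ℕ), ∀ m ∈ C,
      (absGaloisRestrict ℚ (v.adicCompletion ℚ) σ₁) ^ n • m = u ^ n • m := by
    intro n
    induction n with
    | zero => intro m _; rw [pow_zero, one_smul, pow_zero, one_nsmul]
    | succ n ih =>
      intro m hm
      rw [pow_succ, mul_smul, hσ₁ m hm, hcomm, ih m hm, ← mul_nsmul', ← pow_succ']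
  -- `M := u^{N₀} − 1 ≥ 1`
  obtain ⟨M, hM⟩ : ∃ M : ℕ, u ^ N₀ = 1 + M :=
    Nat.exists_eq_add_of_le (Nat.one_le_pow N₀ u (by omega))
  have hMne : M ≠ 0 := by
    intro hM0
    have h1 : 1 < u ^ N₀ := Nat.one_lt_pow hN₀pos.ne' hu
    omega
  -- Step 1: `M • C ⊆ X`, hence `C ⊆ X` by `M`-divisibility of `C`
  have h1a : ∀ m ∈ C, M • m ∈ X := by
    intro m hm
    have hx := hN σ₁ hσ₁I m
    rwa [hpow N₀ m hm, hM, add_nsmul, one_nsmul, add_sub_cancel_left] at hx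
  have hCX : C ≤ X := by
    intro m hm
    obtain ⟨m', hm', rfl⟩ :=
      forall_exists_nsmul_eq_of_pDivisible p hprim C hCdiv hMne m hm
    exact h1a m' hm'
  -- Step 2: `X/C` is a `p`-divisible subgroup of `D = E[p^∞]/C`, `#D[p] = p`, hence `⊥` (as `X ≠ ⊤`)
  have hDprim : ∀ d : N.Gr, ∃ k : ℕ, p ^ k • d = 0 := by
    intro d
    obtain ⟨m, rfl⟩ := N.grMk_surjective d
    obtain ⟨k, hk⟩ := hprim m
    exact ⟨k, by rw [← map_nsmul, hk, map_zero]⟩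
  have hDcard : Nat.card ↥((N.Gr)[(p : ℤ)]) = p := (finite_and_natCard_torsionBy_gr W p N hCdiv hCp).2
  set S : AddSubgroup N.Gr := X.map N.grMk with hSdef
  have hSdiv : ∀ s ∈ S, ∃ s' ∈ S, p • s' = s := by
    rintro _ ⟨x, hx, rfl⟩
    obtain ⟨x', hx', rfl⟩ := hdiv x hx
    exact ⟨N.grMk x', AddSubgroup.mem_map_of_mem _ hx', by rw [map_nsmul]⟩
  rcases eq_bot_or_eq_top_of_pDivisible p hDprim hDcard S hSdiv with
    hbot | htop'
  · refine le_antisymm (fun x hx ↦ ?_) hCX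
    have hx0 : N.grMk x ∈ S := AddSubgroup.mem_map_of_mem _ hx
    rw [hbot, AddSubgroup.mem_bot] at hx0
    have hker : x ∈ N.grMk.ker := hx0
    rwa [N.ker_grMk] at hker
  · exfalso
    apply htop
    rw [eq_top_iff]
    intro m _
    have hm : N.grMk m ∈ S := by rw [htop']; exact AddSubgroup.mem_top _
    obtain ⟨x, hx, hxm⟩ := AddSubgroup.mem_map.1 hm
    have hker : m - x ∈ N.grMk.ker := by
      rw [AddMonoidHom.mem_ker, map_sub, hxm, sub_self]
    rw [N.ker_grMk] at hker
    have := X.add_mem (hCX hker) hx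
    rwa [sub_add_cancel] at this

/-- **Any ramified ordinary line of the same curve equals such a datum.** If `N` has (a)(b)(c) of
`plus_eq_of_inertia_scalar`, every `L` with `IsRamifiedOrdinaryLine W p L` at `v` has
`L.plus = N.plus` (a ramified ordinary line is `p`-divisible, proper, with an inertia power acting
trivially on its quotient). [cite: GreenbergVatsal2000, §2 p. 26] [cite: GreenbergLNM1716, §2 p. 63] -/
theorem plus_eq_plus_of_isRamifiedOrdinaryLine_of_inertia_scalar
    (hCdiv : ∀ c ∈ N.plus, ∃ c' ∈ N.plus, p • c' = c)
    (hCp : Nat.card ↥(N.plus ⊓ (↥(W.geomPrimaryTorsion p))[(p : ℤ)]) = p)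
    (hσ : ∃ σ ∈ absInertia (v.adicCompletion ℚ), ∃ u : ℕ, 1 < u ∧
      ∀ m ∈ N.plus, absGaloisRestrict ℚ (v.adicCompletion ℚ) σ • m = u • m)
    {L : LocalDatum ℚ ↥(W.geomPrimaryTorsion p) v} (hL : IsRamifiedOrdinaryLine W p L) :
    L.plus = N.plus := by
  obtain ⟨hLdiv, hLtop, -, hLn, -⟩ := hL
  exact N.plus_eq_of_inertia_scalar hCdiv hCp hσ L.plus hLdiv hLtop hLn

/-- … and the local data themselves coincide (`LocalDatum.eq_of_plus_eq`). [cite: GreenbergVatsal2000, §2 p. 26] -/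
theorem eq_of_isRamifiedOrdinaryLine_of_inertia_scalar
    (hCdiv : ∀ c ∈ N.plus, ∃ c' ∈ N.plus, p • c' = c)
    (hCp : Nat.card ↥(N.plus ⊓ (↥(W.geomPrimaryTorsion p))[(p : ℤ)]) = p)
    (hσ : ∃ σ ∈ absInertia (v.adicCompletion ℚ), ∃ u : ℕ, 1 < u ∧
      ∀ m ∈ N.plus, absGaloisRestrict ℚ (v.adicCompletion ℚ) σ • m = u • m)
    {L : LocalDatum ℚ ↥(W.geomPrimaryTorsion p) v} (hL : IsRamifiedOrdinaryLine W p L) :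
    L = N :=
  LocalDatum.eq_of_plus_eq (N.plus_eq_plus_of_isRamifiedOrdinaryLine_of_inertia_scalar hCdiv hCp hσ hL)

end Literature.NumberTheory.EllipticCurves.GreenbergSelmer.LocalDatum

/-! ## §2. The scalar `1 + p` on Greenberg's reduction line -/

namespace Summit.BirchSwinnertonDyer.Rank1Residual.Additive.RamifiedOrdinaryLineUnique

variable (V : WeierstrassCurve ℚ) [V.IsGloballyMinimal] [V.IsElliptic] (p : ℕ) [hp : Fact p.Prime]
  {v : HeightOneSpectrum (𝓞 ℚ)}

/-- **An inertia element acts on Greenberg's line `C_v(V)` as `1 + p`.** `V/ℚ` globally minimal,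
`p ∤ Δ_V`, `p ∤ a_p(V)`, `v ∋ p`: there is `σ₁` in the local inertia group with `σ₁ m = (1+p) m` for
EVERY `m ∈ C_v(V)` (one `σ₁` for all levels: `χ_p(σ₁) = 1 + p` by local Kronecker–Weber, and inertia
acts on each `C_v[p^k]` through `χ_p mod p^k`, `OrdinaryLineInertiaCyclotomic`).
[cite: GreenbergVatsal2000, §2 p. 26] [cite: SerreLocalFields1979, Ch. IV §4 Prop. 17] -/
theorem reductionDatum_inertia_scalar (hpv : ((p : ℕ) : 𝓞 ℚ) ∈ v.asIdeal)
    (hΔ : ¬ (p : ℤ) ∣ minimalDiscriminantInt V) (hord : ¬ (p : ℤ) ∣ V.frobeniusTrace p) :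
    ∃ σ ∈ absInertia (v.adicCompletion ℚ), ∀ m ∈ (reductionDatum V p hpv hΔ).plus,
      absGaloisRestrict ℚ (v.adicCompletion ℚ) σ • m = (1 + p) • m := by
  -- `σ₁` with `χ_p(σ₁) = 1 + p`
  have huunit : IsUnit (((1 + p : ℕ)) : ℤ_[p]) := by
    rw [PadicInt.isUnit_iff]
    refine le_antisymm (PadicInt.norm_le_one _) (not_lt.mp fun hlt ↦ ?_)
    have hlt' : ‖((((1 + p : ℕ)) : ℤ) : ℤ_[p])‖ < 1 := by exact_mod_cast hlt
    have hdvd : (p : ℤ) ∣ (((1 + p : ℕ)) : ℤ) := (PadicInt.norm_int_lt_one_iff_dvd _).mp hlt'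
    have hdvd' : p ∣ 1 + p := by exact_mod_cast hdvd
    exact hp.out.ne_one (Nat.dvd_one.mp ((Nat.dvd_add_right (dvd_refl p)).mp
      (by rwa [add_comm] at hdvd')))
  have hvp : (Rat.HeightOneSpectrum.primesEquiv v : ℕ) = p :=
    Rat.HeightOneSpectrum.primesEquiv_eq_of_natCast_mem v hp.out hpv
  obtain ⟨σ₁, hσ₁I, hχ⟩ :=
    adicCompletion_rat_exists_mem_absInertia_cyclotomicCharacter_eq p v hvp huunit.unit
  refine ⟨σ₁, hσ₁I, fun m hm ↦ ?_⟩
  -- work in `E(K̄_v)` through the injection `ι`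
  obtain ⟨k, hk⟩ := exists_pow_nsmul_eq_zero V p m
  obtain ⟨P, hPred, hPord, hPgen, hχP⟩ :=
    exists_generator_inertia_smul_eq_cyclotomicCharacter V p hpv hΔ hord k
  have hinj := GreenbergVatsalTateDatumCofree.pointsMap_coe_injective V p (v := v)
  have hmred : localRed V p hpv hΔ (pointsMap V (v.adicCompletion ℚ) (m : V.geomPoints)) = 0 :=
    (mem_reductionDatum_plus_iff V p hpv hΔ m).1 hm
  have hmk : ((p ^ k : ℕ) : ℤ) • pointsMap V (v.adicCompletion ℚ) (m : V.geomPoints) = 0 := by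
    rw [natCast_zsmul, ← map_nsmul, ← AddSubmonoidClass.coe_nsmul, hk, ZeroMemClass.coe_zero,
      map_zero]
  obtain ⟨j, hj⟩ := hPgen _ hmred hmk
  have hσP : σ₁ • P = (1 + p) • P := by
    rw [hχP σ₁ hσ₁I, hχ, IsUnit.unit_spec, map_natCast, ZMod.val_natCast, ← hPord,
      mod_addOrderOf_nsmul]
  have hcomm : σ₁ • (j • P) = j • (σ₁ • P) :=
    map_nsmul (DistribSMul.toAddMonoidHom (localPoints V (v.adicCompletion ℚ)) σ₁) j P
  apply hinj
  change pointsMap V (v.adicCompletion ℚ)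
      (((absGaloisRestrict ℚ (v.adicCompletion ℚ) σ₁ • m : ↥(V.geomPrimaryTorsion p))) : V.geomPoints) =
    pointsMap V (v.adicCompletion ℚ) ((((1 + p) • m : ↥(V.geomPrimaryTorsion p))) : V.geomPoints)
  rw [primaryComponent.coe_smul, pointsMap_absGaloisRestrict_smul, hj, hcomm, hσP,
    AddSubmonoidClass.coe_nsmul, map_nsmul, hj, ← mul_nsmul', ← mul_nsmul', mul_comm]

/-- **`eq_reductionDatum_plus` re-derived from the datum-level theorem** (consistency: the sibling's
§2 is the instance `u = 1 + p`). [cite: GreenbergVatsal2000, §2 p. 26] [cite: GreenbergLNM1716, §2 p. 63] -/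
theorem eq_reductionDatum_plus' (hpv : ((p : ℕ) : 𝓞 ℚ) ∈ v.asIdeal)
    (hΔ : ¬ (p : ℤ) ∣ minimalDiscriminantInt V) (hord : ¬ (p : ℤ) ∣ V.frobeniusTrace p)
    (X : AddSubgroup ↥(V.geomPrimaryTorsion p))
    (hdiv : ∀ m ∈ X, ∃ m' ∈ X, p • m' = m) (htop : X ≠ ⊤)
    (hN : ∃ N₀ : ℕ, 0 < N₀ ∧ ∀ σ ∈ absInertia (v.adicCompletion ℚ), ∀ m : ↥(V.geomPrimaryTorsion p),
      (absGaloisRestrict ℚ (v.adicCompletion ℚ) σ) ^ N₀ • m - m ∈ X) :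
    X = (reductionDatum V p hpv hΔ).plus := by
  obtain ⟨σ₁, hσ₁I, hσ₁⟩ := reductionDatum_inertia_scalar V p hpv hΔ hord
  exact (reductionDatum V p hpv hΔ).plus_eq_of_inertia_scalar
    (reductionDatum_divisible V p hpv hΔ hord) (natCard_reductionDatum_plus_inf_torsionBy V p hpv hΔ hord)
    ⟨σ₁, hσ₁I, 1 + p, by have := hp.out.one_lt; omega, hσ₁⟩ X hdiv htop hN

end Summit.BirchSwinnertonDyer.Rank1Residual.Additive.RamifiedOrdinaryLineUnique

end
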